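/-
Width seat `ym-line-cbag-p1-w3` (prover-ym-line-cbag-p1-w3-g8-0; own items stmt-QuantumFields-22254 `BoxFloorAllGroups` /
stmt-QuantumFields-22893 `ExpChartPackage2` CLOSED proved), helping LINE 3 `route-QuantumFields-SixPlaneColdBox`
(crux stmt-QuantumFields-25709 `DensityTransferG`, skeleton stub `stub_sixPlaneTransferWithSlackG`): the PER-DATUM lower bound of the 36
box-kernel pair covariances of the six-plane density by the cold-wall ones, with the indefinite datum quadratic form bounded by the
(measurable) kernel-mean excesses — the box-side heart of the six-plane DLR transfer.
-/
import Summits.QuantumFields.YangMills.Theorems.SixPlaneColdBoxFlatBoxCovPairsG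
import Summits.QuantumFields.YangMills.Theorems.SixPlaneColdBoxDirKernelPairsBound
import Summits.QuantumFields.YangMills.Theorems.WeakCouplingRatesBulkDominatesColdBoxWNearCentreEdges

/-!
# LINE 3 `SixPlaneColdBox`, glue: the per-datum lower bound for the 36 pair covariances of the six-plane density under a crude-good datum

For a crude-good datum `ω` of the box kernel `γ_ω = boxKernelG ρ β H ω` (`H = ⌈β^θ⌉`) and the two sites `c_H`, `c_H + Te₀` (`T = ⌈β^A⌉`,
`0 < A < θ ≤ 1/200`), the sharp expansions with datum («KernelCovPairsG» part 3, `datumMinusFlat_sharp`) give, pair by pair over the planes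
`q, q'`: `β²·Cov_ω(c_q, c_{q'}) = β²·Cov_1(c_q, c_{q'}) + 2β·(Σ_c F̄_c(q)F̄_c(q'))·C_D(q,q') ± 2β^{−1/5}` and
`β·Σ_c F̄_c(q)² = β·(E_ω c_q − E_1 c_q) ± 2β^{−1/4}`, while `|C_D(q,q')| ≤ K·β^{−4A}` for every plane pair (`abs_boxDirProjKernel_centre_pair_le_rpow`).
By `2|Σ_c F̄_c(q)F̄_c(q')| ≤ Σ_c F̄_c(q)² + Σ_c F̄_c(q')²` the INDEFINITE datum term is bounded below by the NONNEGATIVE, `ω`-MEASURABLE excesses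
`M_q(ω) = β·E_ω c_q − β·E_1 c_q + 2β^{−1/4}` (no chart datum `ϑ` left in the statement):

* `two_mul_abs_sum_mul_le` — `2|Σ_c X_cY_c| ≤ Σ_c X_c² + Σ_c Y_c²`;
* `pair_cov_lower_of_expansions` — the real bookkeeping of one pair;
* **`sixPlane_goodDatum_cov_lower`** — every compact simple `G`, every `r : LatticeRep G`, `0 < A < θ ≤ 1/200`: `∃ K ≥ 0, β₀` such that for
  `β ≥ β₀` and every crude-good `ω` (scale `β^{2(θ/5)−1}`): all the excesses `M_q(ω)` (at `c_H`) and `M'_{q'}(ω)` (at `c_H + Te₀`) are `≥ 0`, and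
  `Σ_q Σ_{q'} [β²·Cov_1(c_{(c_H;q)}, c_{(c_H+Te₀;q')}) − K·β^{−4A}·(M_q(ω) + M'_{q'}(ω)) − 2β^{−1/5}] ≤ Σ_q Σ_{q'} β²·Cov_ω(c_{(c_H;q)}, c_{(c_H+Te₀;q')})`
  (sums over the six planes `{q : Fin 4 × Fin 4 // q.1 < q.2}`; covariances spelled `∫fg − ∫f∫g`).

With the law of total covariance with a datum-dependent floor (`total_covariance_lower_bound_sub_datumFloor`, w2), the DLR pair identity
(`latticeConnectedCorr_pair_eq_boxKernel_of_rep`, p1), the six-plane pair decomposition (`latticeConnectedCorr_actionDensity_eq_sum_pairs_of_rep`)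
and the bilinearity `cov_sum_sum_eq`, the datum floor integrates to `K·β^{−4A}·Σ(β·(E_torus c_q − E_1 c_q) + 2β^{−1/4} + bad mass)` — which the
crux's hypothesis `TorusMeanNearColdBoxG` makes `≲ β^{−8A−m}`: the slack of `stub_sixPlaneTransferWithSlackG`.  No sorry; no new definition;
standard axioms.  NOT a claim about the Yang–Mills mass gap: glue for a LINE onto the RECORD-type node `LatticeNonFreezing`; the line's cruxes and
every summit statement remain open/untouched.
-/

set_option autoImplicit false

noncomputable section

open MeasureTheory ProbabilityTheory Finset Real Filter Topology Metric
open scoped ENNReal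
open Literature.Probability.LatticeModels (Site glueWith)
open Literature.MathematicalPhysics.QuantumLattice
open Literature.MathematicalPhysics.QuantumFieldTheory
open Literature.MathematicalPhysics.QuantumFieldTheory.LatticeMaxwell
open Literature.MathematicalPhysics.QuantumFieldTheory.AxialGauge
open Summit.QuantumFields.YangMills.Theorems.WeakCouplingRates
open Summit.QuantumFields.YangMills.Theorems.FreeEnergyLogCoefficient

namespace Summit.QuantumFields.YangMills.Theorems.ColdBoxAllGroups

/-! ## Real bookkeeping -/

/-- `2|Σ_c X_c Y_c| ≤ Σ_c X_c² + Σ_c Y_c²` (Cauchy–Schwarz and AM–GM). -/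
theorem two_mul_abs_sum_mul_le {ι : Type*} (s : Finset ι) (X Y : ι → ℝ) :
    2 * |∑ c ∈ s, X c * Y c| ≤ ∑ c ∈ s, X c ^ 2 + ∑ c ∈ s, Y c ^ 2 := by
  have hcs := Finset.sum_mul_sq_le_sq_mul_sq s X Y
  have hP : 0 ≤ ∑ c ∈ s, X c ^ 2 := Finset.sum_nonneg fun c _ => sq_nonneg _
  have hQ : 0 ≤ ∑ c ∈ s, Y c ^ 2 := Finset.sum_nonneg fun c _ => sq_nonneg _
  have hsq : (2 * ∑ c ∈ s, X c * Y c) ^ 2 ≤ (∑ c ∈ s, X c ^ 2 + ∑ c ∈ s, Y c ^ 2) ^ 2 := by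
    nlinarith [sq_nonneg (∑ c ∈ s, X c ^ 2 - ∑ c ∈ s, Y c ^ 2), mul_nonneg hP hQ]
  have h := abs_le_of_sq_le_sq' hsq (by positivity)
  rw [show (2 : ℝ) * |∑ c ∈ s, X c * Y c| = |2 * ∑ c ∈ s, X c * Y c| by
    rw [abs_mul, abs_two]]
  exact abs_le.2 h

/-- The bookkeeping of ONE plane pair: from the datum-minus-flat covariance expansion (`|a − b − 2β·Sxy·C| ≤ e₅`), the two mean expansions
(`β·Sx ≤ Mx`, `β·Sy ≤ My`), `2|Sxy| ≤ Sx + Sy` and the kernel bound `|C| ≤ K₄`: `b − K₄(Mx + My) − e₅ ≤ a`. -/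
theorem pair_cov_lower_of_expansions {a b C Sxy Sx Sy Mx My K₄ e₅ β : ℝ} (hβ : 0 ≤ β)
    (hcov : |a - b - 2 * β * Sxy * C| ≤ e₅) (hxy : 2 * |Sxy| ≤ Sx + Sy) (hC : |C| ≤ K₄)
    (hMx : β * Sx ≤ Mx) (hMy : β * Sy ≤ My) : b - K₄ * (Mx + My) - e₅ ≤ a := by
  have hK₄ : 0 ≤ K₄ := (abs_nonneg C).trans hC
  have hS : 0 ≤ Sx + Sy := le_trans (by positivity) hxy
  -- `|2β·Sxy·C| ≤ β·(Sx+Sy)·K₄ ≤ K₄·(Mx+My)`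
  have h1 : |2 * β * Sxy * C| ≤ β * ((Sx + Sy) * K₄) := by
    rw [show 2 * β * Sxy * C = β * ((2 * Sxy) * C) by ring, abs_mul, abs_of_nonneg hβ, abs_mul]
    refine mul_le_mul_of_nonneg_left ?_ hβ
    have h2 : |2 * Sxy| = 2 * |Sxy| := by rw [abs_mul, abs_two]
    rw [h2]
    exact mul_le_mul hxy hC (abs_nonneg _) hS
  have h2 : β * ((Sx + Sy) * K₄) ≤ K₄ * (Mx + My) := by nlinarith
  have h3 := (abs_le.1 (h1.trans h2)).1
  have h4 := (abs_le.1 hcov).1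
  linarith

/-! ## The per-datum lower bound -/

/-- **The 36 pair covariances of the six-plane density under a crude-good datum dominate the cold-wall ones up to the datum floor and
`2β^{−1/5}` per pair.**  For every compact simple `G`, every `r : LatticeRep G` and exponents `0 < A < θ ≤ 1/200` there are `K ≥ 0` and `β₀` such
that for `β ≥ β₀` (`H = ⌈β^θ⌉`, `T = ⌈β^A⌉`) and every crude-good datum `ω` (scale `β^{2(θ/5)−1}`): the kernel-mean excesses
`M_q(ω) = β·E_ω c_{(c_H;q)} − β·E_1 c_{(c_H;q)} + 2β^{−1/4}` and `M'_{q'}(ω)` (same at `c_H + Te₀`) are nonnegative for every plane, and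
`Σ_q Σ_{q'} [β²·Cov_1(c_{(c_H;q)}, c_{(c_H+Te₀;q')}) − K·β^{−4A}·(M_q(ω) + M'_{q'}(ω)) − 2β^{−1/5}] ≤ Σ_q Σ_{q'} β²·Cov_ω(c_{(c_H;q)}, c_{(c_H+Te₀;q')})`. -/
theorem sixPlane_goodDatum_cov_lower
    (G : Type) [Group G] [TopologicalSpace G] [IsTopologicalGroup G] [CompactSpace G] [MeasurableSpace G] [BorelSpace G]
    (hG : IsCompactSimpleLieGroup G) (r : LatticeRep G) {A θ : ℝ} (hA : 0 < A) (hAθ : A < θ) (hθ2 : θ ≤ 1 / 200) :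
    ∃ K : ℝ, 0 ≤ K ∧ ∃ β₀ : ℝ, ∀ β : ℝ, β₀ ≤ β → ∀ ω : LGConfig 4 G, CrudeGoodG r.ρ β (θ / 5) ⌈β ^ θ⌉₊ ω →
      (∀ q : {q : Fin 4 × Fin 4 // q.1 < q.2},
        0 ≤ β * (∫ U, plaqCostAt r.ρ (boxCentre ⌈β ^ θ⌉₊) q.1.1 q.1.2 U ∂(boxKernelG r.ρ β ⌈β ^ θ⌉₊ ω)) -
            β * (∫ U, plaqCostAt r.ρ (boxCentre ⌈β ^ θ⌉₊) q.1.1 q.1.2 U ∂(boxState r.ρ β ⌈β ^ θ⌉₊)) + 2 * β ^ (-(1 / 4 : ℝ))) ∧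
      (∀ q' : {q : Fin 4 × Fin 4 // q.1 < q.2},
        0 ≤ β * (∫ U, plaqCostAt r.ρ (boxCentre ⌈β ^ θ⌉₊ + Pi.single 0 (⌈β ^ A⌉₊ : ℤ)) q'.1.1 q'.1.2 U ∂(boxKernelG r.ρ β ⌈β ^ θ⌉₊ ω)) -
            β * (∫ U, plaqCostAt r.ρ (boxCentre ⌈β ^ θ⌉₊ + Pi.single 0 (⌈β ^ A⌉₊ : ℤ)) q'.1.1 q'.1.2 U ∂(boxState r.ρ β ⌈β ^ θ⌉₊)) +
            2 * β ^ (-(1 / 4 : ℝ))) ∧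
      ∑ q : {q : Fin 4 × Fin 4 // q.1 < q.2}, ∑ q' : {q : Fin 4 × Fin 4 // q.1 < q.2},
          (β ^ 2 * ((∫ U, plaqCostAt r.ρ (boxCentre ⌈β ^ θ⌉₊) q.1.1 q.1.2 U *
                plaqCostAt r.ρ (boxCentre ⌈β ^ θ⌉₊ + Pi.single 0 (⌈β ^ A⌉₊ : ℤ)) q'.1.1 q'.1.2 U ∂(boxState r.ρ β ⌈β ^ θ⌉₊)) -
              (∫ U, plaqCostAt r.ρ (boxCentre ⌈β ^ θ⌉₊) q.1.1 q.1.2 U ∂(boxState r.ρ β ⌈β ^ θ⌉₊)) *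
                (∫ U, plaqCostAt r.ρ (boxCentre ⌈β ^ θ⌉₊ + Pi.single 0 (⌈β ^ A⌉₊ : ℤ)) q'.1.1 q'.1.2 U ∂(boxState r.ρ β ⌈β ^ θ⌉₊))) -
            K * β ^ (-(4 * A)) *
              ((β * (∫ U, plaqCostAt r.ρ (boxCentre ⌈β ^ θ⌉₊) q.1.1 q.1.2 U ∂(boxKernelG r.ρ β ⌈β ^ θ⌉₊ ω)) -
                  β * (∫ U, plaqCostAt r.ρ (boxCentre ⌈β ^ θ⌉₊) q.1.1 q.1.2 U ∂(boxState r.ρ β ⌈β ^ θ⌉₊)) + 2 * β ^ (-(1 / 4 : ℝ))) +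
                (β * (∫ U, plaqCostAt r.ρ (boxCentre ⌈β ^ θ⌉₊ + Pi.single 0 (⌈β ^ A⌉₊ : ℤ)) q'.1.1 q'.1.2 U ∂(boxKernelG r.ρ β ⌈β ^ θ⌉₊ ω)) -
                  β * (∫ U, plaqCostAt r.ρ (boxCentre ⌈β ^ θ⌉₊ + Pi.single 0 (⌈β ^ A⌉₊ : ℤ)) q'.1.1 q'.1.2 U ∂(boxState r.ρ β ⌈β ^ θ⌉₊)) +
                  2 * β ^ (-(1 / 4 : ℝ)))) -
            2 * β ^ (-(1 / 5 : ℝ))) ≤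
        ∑ q : {q : Fin 4 × Fin 4 // q.1 < q.2}, ∑ q' : {q : Fin 4 × Fin 4 // q.1 < q.2},
          β ^ 2 * ((∫ U, plaqCostAt r.ρ (boxCentre ⌈β ^ θ⌉₊) q.1.1 q.1.2 U *
                plaqCostAt r.ρ (boxCentre ⌈β ^ θ⌉₊ + Pi.single 0 (⌈β ^ A⌉₊ : ℤ)) q'.1.1 q'.1.2 U ∂(boxKernelG r.ρ β ⌈β ^ θ⌉₊ ω)) -
              (∫ U, plaqCostAt r.ρ (boxCentre ⌈β ^ θ⌉₊) q.1.1 q.1.2 U ∂(boxKernelG r.ρ β ⌈β ^ θ⌉₊ ω)) *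
                (∫ U, plaqCostAt r.ρ (boxCentre ⌈β ^ θ⌉₊ + Pi.single 0 (⌈β ^ A⌉₊ : ℤ)) q'.1.1 q'.1.2 U ∂(boxKernelG r.ρ β ⌈β ^ θ⌉₊ ω))) := by
  have hθ : 0 < θ := hA.trans hAθ
  obtain ⟨K, hK0, βK, hK⟩ := abs_boxDirProjKernel_centre_pair_le_rpow hA hAθ
  obtain ⟨CE, β₁, hD⟩ := datumMinusFlat_sharp G hG r hθ hθ2
  obtain ⟨β₂, hβ₂1, h16⟩ := exists_const_mul_rpow_le_rpow 16 hAθ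
  refine ⟨K, hK0, max (max βK β₁) β₂, fun β hβ ω hω => ?_⟩
  have hbK : βK ≤ β := ((le_max_left _ _).trans (le_max_left _ _)).trans hβ
  have hb₁ : β₁ ≤ β := ((le_max_right _ _).trans (le_max_left _ _)).trans hβ
  have hb₂ : β₂ ≤ β := (le_max_right _ _).trans hβ
  have hβ1 : 1 ≤ β := hβ₂1.trans hb₂
  have hβ0 : 0 ≤ β := by linarith
  -- `8T ≤ H`, hence both sites are within `H/8` of the centre
  have h8T : 8 * ⌈β ^ A⌉₊ ≤ ⌈β ^ θ⌉₊ := by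
    have h2 := natCeil_rpow_le_two_mul hβ1 hA.le
    have h := h16 β hb₂
    have hH : β ^ θ ≤ (⌈β ^ θ⌉₊ : ℝ) := Nat.le_ceil _
    have hr : (8 * ⌈β ^ A⌉₊ : ℝ) ≤ (⌈β ^ θ⌉₊ : ℝ) := by linarith
    exact_mod_cast hr
  have hx : ∀ n : Fin 4, 8 * |(boxCentre ⌈β ^ θ⌉₊ : Site 4) n - (⌈β ^ θ⌉₊ : ℤ)| ≤ (⌈β ^ θ⌉₊ : ℤ) :=
    (centre_pair_near_centre h8T).1
  have hy : ∀ n : Fin 4, 8 * |(boxCentre ⌈β ^ θ⌉₊ + Pi.single 0 (⌈β ^ A⌉₊ : ℤ) : Site 4) n - (⌈β ^ θ⌉₊ : ℤ)| ≤ (⌈β ^ θ⌉₊ : ℤ) :=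
    (centre_pair_near_centre h8T).2
  -- the expansion data of this datum
  obtain ⟨ϑ, s, -, hcov, hmean⟩ := hD β hb₁ ω hω
  have hsq : ∀ (X : Fin (dimE r.ρ) → ℝ), 0 ≤ β * ∑ c, X c ^ 2 := fun X =>
    mul_nonneg hβ0 (Finset.sum_nonneg fun c _ => sq_nonneg _)
  refine ⟨fun q => ?_, fun q' => ?_, ?_⟩
  · have h := (abs_le.1 (hmean _ hx q.1.1 q.1.2 q.2)).1
    linarith [hsq (fun c => sCirc (glue (pin := fun e => e ∉ dirFreeEdges ⌈β ^ θ⌉₊) dirCorner (2 * ⌈β ^ θ⌉₊ + 3) (ϑ c)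
      (mean (fun e => e ∉ dirFreeEdges ⌈β ^ θ⌉₊) dirCorner (2 * ⌈β ^ θ⌉₊ + 3) (ϑ c))) (boxCentre ⌈β ^ θ⌉₊, q.1.1, q.1.2))]
  · have h := (abs_le.1 (hmean _ hy q'.1.1 q'.1.2 q'.2)).1
    linarith [hsq (fun c => sCirc (glue (pin := fun e => e ∉ dirFreeEdges ⌈β ^ θ⌉₊) dirCorner (2 * ⌈β ^ θ⌉₊ + 3) (ϑ c)
      (mean (fun e => e ∉ dirFreeEdges ⌈β ^ θ⌉₊) dirCorner (2 * ⌈β ^ θ⌉₊ + 3) (ϑ c)))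
        (boxCentre ⌈β ^ θ⌉₊ + Pi.single 0 (⌈β ^ A⌉₊ : ℤ), q'.1.1, q'.1.2))]
  · refine Finset.sum_le_sum fun q _ => Finset.sum_le_sum fun q' _ => ?_
    have hc := hcov _ _ hx hy q.1.1 q.1.2 q'.1.1 q'.1.2 q.2 q'.2
    have hCK := (hK β hbK q.1.1 q.1.2 q'.1.1 q'.1.2 q.2 q'.2).1
    have hMx := (abs_le.1 (hmean _ hx q.1.1 q.1.2 q.2)).1
    have hMy := (abs_le.1 (hmean _ hy q'.1.1 q'.1.2 q'.2)).1
    have hxy := two_mul_abs_sum_mul_le Finset.univ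
      (fun c => sCirc (glue (pin := fun e => e ∉ dirFreeEdges ⌈β ^ θ⌉₊) dirCorner (2 * ⌈β ^ θ⌉₊ + 3) (ϑ c)
        (mean (fun e => e ∉ dirFreeEdges ⌈β ^ θ⌉₊) dirCorner (2 * ⌈β ^ θ⌉₊ + 3) (ϑ c))) (boxCentre ⌈β ^ θ⌉₊, q.1.1, q.1.2))
      (fun c => sCirc (glue (pin := fun e => e ∉ dirFreeEdges ⌈β ^ θ⌉₊) dirCorner (2 * ⌈β ^ θ⌉₊ + 3) (ϑ c)
        (mean (fun e => e ∉ dirFreeEdges ⌈β ^ θ⌉₊) dirCorner (2 * ⌈β ^ θ⌉₊ + 3) (ϑ c)))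
          (boxCentre ⌈β ^ θ⌉₊ + Pi.single 0 (⌈β ^ A⌉₊ : ℤ), q'.1.1, q'.1.2))
    beta_reduce at hxy
    exact pair_cov_lower_of_expansions hβ0 hc hxy hCK (by linarith) (by linarith)

end Summit.QuantumFields.YangMills.Theorems.ColdBoxAllGroups

end
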